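/-
Origin: expansion seat `planner-pub-hodgecm-pv03-0`, handover v5 2026-08-18T04:05:52Z (latest in place at cutoff) (`HOME/pub-hodgecm-pv03/lean/Pv03/PerL34/BallDeriv.lean`, md5 58687110, 82 lines);
landed by the gen-5 packager in gate run 21 as `HodgeCM/PerL34/BallDeriv.lean` (verbatim).
-/
/-
Copyright: pub-hodgecm formalisation cell (harness21, 2026). New file (not vendored).
Origin: HOME/pub-hodgecm-pv03/lean/Pv03/PerL34/BallDeriv.lean (WIP module `Pv03.PerL34.BallDeriv`; intended final place
`HodgeCM/PerL34/BallDeriv.lean` = module `HodgeCM.PerL34.BallDeriv`) (seat planner-pub-hodgecm-pv03-0, DAG node N33).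
-/
import Summits.HodgeConjecture.HodgeCM.PerL34.Ball_2

/-!
# `Jac g z` IS the derivative of `z ↦ g • z`

`Ball.lean` DEFINES `Jac g z` by the quotient-rule formula `(g_{ij} w₂ - w_i g_{2j}) / w₂²`, `w = g·(z,1)`.  This file
certifies the label: `hasFDerivAt_actVec` — the coordinate expression `actVec g : ℂ² → ℂ²` of the action
(`actVec g z = (g • z)` on the ball, `actVec_eq`) has Fréchet derivative `y ↦ Jac g z · y` at every point of the
ball.  Consequently the automorphy factor `J g x = (Jac g x)ᵀ` of `BallUniformisation.ballData` is the transpose of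
the differential `(d g)_x`, i.e. the factor by which one-forms pull back: `(g^* u)(x) = ᵗ(dg)_x · u(g x)`.
Pure Mathlib; everything PROVED.
-/

noncomputable section

open Matrix

namespace HodgeCM
namespace PerL34
namespace BallModel

/-- The action of `g` in the coordinates `(z₀, z₁)`, by the same formula on all of `ℂ²`
(meaningful where the third homogeneous coordinate `w₂` is nonzero, in particular on the ball). -/
def actVec (g : U21) (y : Fin 2 → ℂ) : Fin 2 → ℂ :=
  fun i => (mat g *ᵥ ![y 0, y 1, 1]) (Fin.castSucc i) / (mat g *ᵥ ![y 0, y 1, 1]) 2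

/-- (Ported verbatim from the HodgeCMPerL package; no docstring in the source.) -/
theorem lift_eq (z : Ball) : lift z = ![z.1 0, z.1 1, 1] := rfl

/-- (Ported verbatim from the HodgeCMPerL package; no docstring in the source.) -/
theorem actVec_eq (g : U21) (z : Ball) : actVec g z.1 = (g • z).1 := by
  funext i
  rw [smul_val, actVec]
  rfl

/-- The linear part `y ↦ g_{k0} y₀ + g_{k1} y₁` of the `k`-th homogeneous coordinate of `g·(y,1)`. -/
def rowCLM (g : U21) (k : Fin 3) : (Fin 2 → ℂ) →L[ℂ] ℂ :=
  mat g k 0 • ContinuousLinearMap.proj 0 + mat g k 1 • ContinuousLinearMap.proj 1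

/-- (Ported verbatim from the HodgeCMPerL package; no docstring in the source.) -/
@[simp] theorem rowCLM_apply (g : U21) (k : Fin 3) (y : Fin 2 → ℂ) :
    rowCLM g k y = mat g k 0 * y 0 + mat g k 1 * y 1 := by
  simp [rowCLM]

/-- (Ported verbatim from the HodgeCMPerL package; no docstring in the source.) -/
theorem homog_eq (g : U21) (k : Fin 3) (y : Fin 2 → ℂ) :
    (mat g *ᵥ ![y 0, y 1, 1]) k = rowCLM g k y + mat g k 2 := by
  simp [Matrix.mulVec, dotProduct, Fin.sum_univ_three]

/-- (Ported verbatim from the HodgeCMPerL package; no docstring in the source.) -/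
theorem hasFDerivAt_homog (g : U21) (k : Fin 3) (y₀ : Fin 2 → ℂ) :
    HasFDerivAt (fun y : Fin 2 → ℂ => (mat g *ᵥ ![y 0, y 1, 1]) k) (rowCLM g k) y₀ := by
  have : (fun y : Fin 2 → ℂ => (mat g *ᵥ ![y 0, y 1, 1]) k) = fun y => rowCLM g k y + mat g k 2 :=
    funext (homog_eq g k)
  rw [this]
  exact (rowCLM g k).hasFDerivAt.add_const _

/-- **`Jac g z` is the Jacobian:** the coordinate action map has Fréchet derivative `y ↦ Jac g z · y` at `z`. -/
theorem hasFDerivAt_actVec (g : U21) (z : Ball) :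
    HasFDerivAt (actVec g) (LinearMap.toContinuousLinearMap (Matrix.mulVecLin (Jac g z))) z.1 := by
  have hD0 : (mat g *ᵥ ![z.1 0, z.1 1, 1]) 2 ≠ 0 := W3_2_ne_zero g z
  have hinv : HasFDerivAt (fun y : Fin 2 → ℂ => ((mat g *ᵥ ![y 0, y 1, 1]) 2)⁻¹)
      ((ContinuousLinearMap.toSpanSingleton ℂ (-((mat g *ᵥ ![z.1 0, z.1 1, 1]) 2 ^ 2)⁻¹)).comp (rowCLM g 2))
      z.1 :=
    (hasFDerivAt_inv hD0).comp z.1 (hasFDerivAt_homog g 2 z.1)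
  rw [hasFDerivAt_pi']
  intro i
  have hfun : (fun y => actVec g y i) =
      fun y => (mat g *ᵥ ![y 0, y 1, 1]) (Fin.castSucc i) * ((mat g *ᵥ ![y 0, y 1, 1]) 2)⁻¹ := by
    funext y; rw [actVec, div_eq_mul_inv]
  rw [hfun]
  refine ((hasFDerivAt_homog g (Fin.castSucc i) z.1).fun_mul hinv).congr_fderiv ?_
  ext y
  have hW : ∀ k, (mat g *ᵥ ![z.1 0, z.1 1, 1]) k = W3 g z k := fun k => rfl
  simp only [hW] at hD0 ⊢
  fin_cases i <;> (simp [Jac]; field_simp; ring)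

end BallModel
end PerL34
end HodgeCM

end
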